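import Literature.NumberTheory.Automorphic.SupercuspidalRestriction
import HarnessLib

/-!
# Supercuspidality of subrepresentations and transport along topological isomorphisms

Generic complements to `SupercuspidalRestriction` about `Representation.IsSupercuspidal` (smooth
matrix coefficients compactly supported modulo the centre; Harish-Chandra 1970,
Bernstein–Zelevinsky 1976, §3.21), used to pass supercuspidality from an irreducible
supercuspidal representation of a Levi subgroup `Π_a GL_{n_a}(F)` to its tensor factors
(Bernstein–Zelevinsky 1977, §4.7):

* `exists_mem_contragredient_comp_eq` — **extension of smooth linear forms**: for an injective
  intertwining map `T : ρ → σ` into a *smooth* representation of a group with a compact open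
  subgroup, every smooth form `φ ∈ ρ̃` is `Φ ∘ T` for some smooth form `Φ ∈ σ̃`
  (`Φ = (φ ∘ T⁻¹)~ ∘ e_K`, `e_K` the averaging projector of `SmoothProjector`);
* `IsSupercuspidal.of_injective` — hence a **subrepresentation of a smooth supercuspidal
  representation is supercuspidal** (its coefficients are coefficients of the ambient one);
* `IsSupercuspidal.comp_mulEquiv` — transport along an isomorphism of topological groups;
* `exists_isOpen_isCompact_subgroup` — a nonarchimedean locally compact group has a compact open
  subgroup.

Theorems only; no definitions, no named facts.

## References

* I. N. Bernstein, A. V. Zelevinsky, *Representations of the group `GL(n, F)` where `F` is a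
  non-archimedean local field*, Russian Math. Surveys 31:3 (1976), §2.3, §3.21.
  [BernsteinZelevinskyRMS1976]
* I. N. Bernstein, A. V. Zelevinsky, *Induced representations of reductive `p`-adic groups I*,
  Ann. Sci. ÉNS 10 (1977), §4.7. [BernsteinZelevinskyASENS1977]
-/

noncomputable section

open scoped Pointwise

namespace Representation

open Literature.NumberTheory.Automorphic Literature.NumberTheory.Automorphic.SmoothProjector

/-! ### Compact open subgroups -/

section CompactOpen

variable {G : Type*} [Group G] [TopologicalSpace G] [NonarchimedeanGroup G] [LocallyCompactSpace G]

/-- **A nonarchimedean locally compact group has a compact open subgroup**: an open subgroup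
inside a compact neighbourhood of `1` (open subgroups are closed). [folklore] -/
theorem exists_isOpen_isCompact_subgroup :
    ∃ K : Subgroup G, IsOpen (K : Set G) ∧ IsCompact (K : Set G) := by
  obtain ⟨C, hC, hC1⟩ := exists_compact_mem_nhds (1 : G)
  obtain ⟨V, hV⟩ := NonarchimedeanGroup.is_nonarchimedean C hC1
  exact ⟨V, V.isOpen, hC.of_isClosed_subset (V.isClosed) hV⟩

end CompactOpen

/-! ### Smooth vectors and injective intertwining maps -/

section Injective

variable {k G V W : Type*} [Field k] [Group G] [TopologicalSpace G]
  [AddCommGroup V] [Module k V] [AddCommGroup W] [Module k W]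
  {ρ : Representation k G V} {σ : Representation k G W}

omit [TopologicalSpace G] in
/-- Along an injective intertwining map the stabilisers agree: `Stab_ρ(v) = Stab_σ(T v)`. [folklore] -/
theorem stabilizerSubgroup_eq_of_injective (T : ρ.IntertwiningMap σ) (hT : Function.Injective T)
    (v : V) : ρ.stabilizerSubgroup v = σ.stabilizerSubgroup (T v) := by
  ext g
  rw [mem_stabilizerSubgroup, mem_stabilizerSubgroup, ← T.isIntertwining]
  exact ⟨fun h => by rw [h], fun h => hT h⟩

/-- A representation embedding into a smooth representation is smooth. [folklore] -/
theorem IsSmooth.of_injective (hσ : σ.IsSmooth) (T : ρ.IntertwiningMap σ)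
    (hT : Function.Injective T) : ρ.IsSmooth := fun v => by
  rw [isSmoothVector_iff, stabilizerSubgroup_eq_of_injective T hT v]
  exact hσ (T v)

end Injective

/-! ### Extension of smooth linear forms -/

section Extension

variable {k G V W : Type*} [Field k] [CharZero k] [Group G] [TopologicalSpace G]
  [IsTopologicalGroup G] [AddCommGroup V] [Module k V] [AddCommGroup W] [Module k W]
  {ρ : Representation k G V} {σ : Representation k G W}

/-- **Extension of smooth linear forms along an injective intertwining map.** Let `σ` be smooth,
`K₀ ≤ G` compact open, `T : ρ → σ` an injective intertwining map and `φ ∈ ρ̃` a smooth linear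
form on `V`. Then there is a smooth linear form `Φ ∈ σ̃` on `W` with `Φ ∘ T = φ`: with `K ≤ K₀`
compact open fixing `φ`, `S` a linear left inverse of `T` and `e_K` the `K`-averaging projector
of `σ` (`SmoothProjector.avgLinear`), take `Φ = φ ∘ S ∘ e_K`; then `Φ` is `K`-invariant, and
`Φ (T v) = φ (S (T (e_K v))) = φ (e_K v) = φ v` by naturality of `e_K` (`map_avg`) and
`K`-invariance of `φ` (`dual_apply_avg`). (Bernstein–Zelevinsky 1976, §2.3.)
[cite: BernsteinZelevinskyRMS1976, §2.3] -/
theorem exists_mem_contragredient_comp_eq (hσ : σ.IsSmooth) {K₀ : Subgroup G}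
    (hK₀o : IsOpen (K₀ : Set G)) (hK₀c : IsCompact (K₀ : Set G)) (T : ρ.IntertwiningMap σ)
    (hT : Function.Injective T) {φ : Module.Dual k V} (hφ : φ ∈ ρ.contragredient) :
    ∃ Φ ∈ σ.contragredient, Φ ∘ₗ T.toLinearMap = φ := by
  have hρ : ρ.IsSmooth := IsSmooth.of_injective hσ T hT
  -- `K = K₀ ⊓ Stab(φ)`, compact open, fixing `φ`
  rw [mem_contragredient] at hφ
  set K : Subgroup G := K₀ ⊓ ρ.dual.stabilizerSubgroup φ with hK
  have hKo : IsOpen (K : Set G) := hK₀o.inter hφ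
  have hKc : IsCompact (K : Set G) :=
    hK₀c.of_isClosed_subset (K.isClosed_of_isOpen hKo) fun g hg => hg.1
  have hKφ : ∀ g ∈ K, ρ.dual g φ = φ := fun g hg => hg.2
  -- a linear left inverse of `T`
  obtain ⟨S, hS⟩ := T.toLinearMap.exists_leftInverse_of_injective
    (LinearMap.ker_eq_bot.2 (by exact hT))
  refine ⟨(φ ∘ₗ S) ∘ₗ avgLinear K hσ hKc, ?_, ?_⟩
  · -- `Φ` is `K`-invariant, hence smooth
    rw [mem_contragredient]
    refine σ.dual.isSmoothVector_of_le hKo fun g hg => ?_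
    rw [mem_stabilizerSubgroup]
    refine LinearMap.ext fun w => ?_
    simp only [dual_apply, Module.Dual.transpose_apply, LinearMap.comp_apply]
    change φ (S (avg σ K (σ g⁻¹ w))) = φ (S (avg σ K w))
    rw [avg_apply_of_mem (K.inv_mem hg)]
  · refine LinearMap.ext fun v => ?_
    simp only [LinearMap.comp_apply, IntertwiningMap.coe_toLinearMap]
    change φ (S (avg σ K (T v))) = φ v
    rw [← map_avg hKc T (hρ v), ← IntertwiningMap.coe_toLinearMap, ← LinearMap.comp_apply S, hS,
      LinearMap.id_apply, dual_apply_avg hKc (hρ v) hKφ]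

/-- **A subrepresentation of a smooth supercuspidal representation is supercuspidal**: if
`T : ρ → σ` is an injective intertwining map, `σ` smooth and supercuspidal and `G` has a compact
open subgroup, then `ρ` is supercuspidal — the coefficient `c_{φ,v}` of `ρ` is the coefficient
`c_{Φ, T v}` of `σ` for any smooth extension `Φ` of `φ` (`exists_mem_contragredient_comp_eq`).
(Bernstein–Zelevinsky 1976, §3.21: subquotients of quasi-cuspidal representations.)
[cite: BernsteinZelevinskyRMS1976, §3.21] -/
theorem IsSupercuspidal.of_injective (hσc : σ.IsSupercuspidal) (hσ : σ.IsSmooth) {K₀ : Subgroup G}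
    (hK₀o : IsOpen (K₀ : Set G)) (hK₀c : IsCompact (K₀ : Set G)) (T : ρ.IntertwiningMap σ)
    (hT : Function.Injective T) : ρ.IsSupercuspidal := by
  intro φ hφ v
  obtain ⟨Φ, hΦ, hΦT⟩ := exists_mem_contragredient_comp_eq hσ hK₀o hK₀c T hT hφ
  obtain ⟨C, hC, hsupp⟩ := hσc Φ hΦ (T v)
  refine ⟨C, hC, fun g hg => hsupp ?_⟩
  rw [Function.mem_support, matrixCoeff_apply] at hg ⊢
  rwa [← T.isIntertwining, ← IntertwiningMap.coe_toLinearMap, ← LinearMap.comp_apply, hΦT]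

end Extension

/-! ### Transport along isomorphisms of topological groups -/

section Transport

variable {k G G' V : Type*} [CommRing k] [Group G] [Group G'] [TopologicalSpace G]
  [TopologicalSpace G'] [IsTopologicalGroup G] [IsTopologicalGroup G']
  [AddCommGroup V] [Module k V] {ρ : Representation k G V}

/-- A smooth form for `ρ ∘ e` (`e` an open homomorphism) is a smooth form for `ρ`. [folklore] -/
theorem mem_contragredient_of_comp {e : G' →* G} (he : IsOpenMap e)
    {φ : Module.Dual k V} (hφ : φ ∈ Representation.contragredient (G := G') (ρ.comp e)) :
    φ ∈ ρ.contragredient := by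
  rw [mem_contragredient] at hφ ⊢
  have hle : ((Representation.dual (G := G') (ρ.comp e)).stabilizerSubgroup φ).map e ≤
      ρ.dual.stabilizerSubgroup φ := by
    rintro _ ⟨h, hh, rfl⟩
    rw [SetLike.mem_coe, mem_stabilizerSubgroup] at hh
    rw [mem_stabilizerSubgroup]
    refine LinearMap.ext fun v => ?_
    have := LinearMap.congr_fun hh v
    simp only [dual_apply, Module.Dual.transpose_apply, LinearMap.comp_apply] at this ⊢
    rwa [MonoidHom.comp_apply, map_inv] at this
  exact Subgroup.isOpen_mono hle (he _ hφ)

/-- **Supercuspidality is transported along continuous open surjective homomorphisms with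
central kernel... in the simplest case of an isomorphism of topological groups**: if
`e : G' ≃* G` is an open (hence, being bijective, a homeomorphism onto its image direction
needed here: `e⁻¹` continuous) isomorphism and `ρ` is supercuspidal then so is `ρ ∘ e`
(coefficients `c ∘ e`, `e⁻¹(C · Z(G)) = e⁻¹(C) · Z(G')`). [folklore] -/
theorem IsSupercuspidal.comp_mulEquiv (hρ : ρ.IsSupercuspidal) (e : G' ≃* G)
    (he' : IsOpenMap e) : IsSupercuspidal (G := G') (ρ.comp e.toMonoidHom) := by
  intro φ hφ v
  obtain ⟨C, hC, hsupp⟩ := hρ φ (mem_contragredient_of_comp (e := e.toMonoidHom) he' hφ) v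
  have hec : Continuous e.symm := by
    rw [continuous_def]
    intro U hU
    rw [show (e.symm ⁻¹' U : Set G) = e '' U from (e.toEquiv.image_eq_preimage_symm U).symm]
    exact he' U hU
  refine ⟨e.symm '' C, hC.image hec, fun g hg => ?_⟩
  have hg' : e g ∈ Function.support (ρ.matrixCoeff φ v) := by
    rw [Function.mem_support, matrixCoeff_apply] at hg ⊢
    exact hg
  obtain ⟨c, hc, z, hz, hcz⟩ := Set.mem_mul.1 (hsupp hg')
  refine Set.mem_mul.2 ⟨e.symm c, Set.mem_image_of_mem _ hc, e.symm z, ?_, ?_⟩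
  · rw [SetLike.mem_coe, Subgroup.mem_center_iff] at hz ⊢
    intro h
    apply e.injective
    rw [map_mul, map_mul, MulEquiv.apply_symm_apply]
    exact hz (e h)
  · apply e.injective
    rw [map_mul, MulEquiv.apply_symm_apply, MulEquiv.apply_symm_apply]
    exact hcz

end Transport

end Representation
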